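import Summits.RiemannHypothesis.RiemannHypothesis.Theorems.WeilFormatCCinfDoorCert
import Summits.RiemannHypothesis.RiemannHypothesis.Theorems.WeilFormatCCinfFloors
import HarnessLib

/-!
# Format C, design C∞: the certificate front door with TABLE floors and a GENERIC odd far floor

Route context: Fourier–Galerkin / Schur-complement certificates of Weil positivity on a window ("format C", C∞ door;
cell memo `run/shared/lean/pub/rh-explicit/rh-explicit-weil-10/KERNEL-LEVER.md` §22–§23; supporting stmt-RiemannHypothesis-0098;
seat rh-explicit-weil-10).  This is `weilPositivityOn_of_cinf_table` (`WeilFormatCCinfDoorTable`) with ONE change: the odd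
sector's far floor is taken as the ∀-statement `hfaro : ∀ k ≥ m₀o, d₁o ≤ d̂⁻_atan,A(k)` (exact arctan penalty at every far
kernel index) instead of the single check `d₁o ≤ core(m₀o) − π/4 − consts`.  The rung discharges `hfaro` either from that
single `π/4` check (`odd_dhat_core_mono` + `hilbert_atan_penalty_le`, as before) or — ≈ 22 % better at `a = 1` — from the single
EXACT check `d₁o ≤ d̂⁻_atan,A(m₀o)` via `WeilFormatCCinfOddFloorMono.cinf_far_floor_odd_exact` (monotone from `m₀o` on when
`Bo ≤ m₀o+1`, `2a² ≤ m₀o+1`); both adapters live in `WeilFormatCCinfFloorsKit`.  Everything else (even sector, table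
weights, blocks, certificates) is byte-identical to the table door.

* `cinf_dhat_le_of_far` — `d̂ := if k < m₀ then wtab k else d₁` is below `g` from the table checks and a far floor;
* `weilPositivityOn_of_cinf_tableG`.

Assembly only; standard axioms; no definitions; no RH claim (a rung `WeilPositivityOn a` is one case of
`riemannHypothesis_iff_forall_weilPositivityOn`).
-/

set_option autoImplicit false
-- `Summit.RiemannHypothesis.RiemannHypothesis.…` is the layout-mandated namespace (summit = problem name).
set_option linter.dupNamespace false

noncomputable section

open Complex Filter Set MeasureTheory Finset
open scoped Real Topology ComplexConjugate ArithmeticFunction.vonMangoldt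

namespace Summit.RiemannHypothesis.RiemannHypothesis.Theorems.WeilFormatC

open Literature.NumberTheory.LFunctions Literature.NumberTheory.LFunctions.Yoshida1992
open Literature.Analysis.SpecialFunctions

variable {a : ℝ}

/-- `d̂ := if k < m₀ then wtab k else d₁` is below `g` on `[B, ∞)` from the table checks on `[B, m₀)` and the far
floor `∀ k ≥ m₀, d₁ ≤ g k`. -/
theorem cinf_dhat_le_of_far {B m₀ : ℕ} (wtab : ℕ → ℝ) {d₁ : ℝ} {g : ℕ → ℝ}
    (htab : ∀ k : ℕ, B ≤ k → k < m₀ → wtab k ≤ g k) (hfar : ∀ k : ℕ, m₀ ≤ k → d₁ ≤ g k) :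
    ∀ k : ℕ, B ≤ k → (if k < m₀ then wtab k else d₁) ≤ g k := by
  intro k hk
  by_cases h : k < m₀
  · rw [if_pos h]; exact htab k hk h
  · rw [if_neg h]; exact hfar k (not_lt.1 h)

/-- **Format C, C∞ certificate door with table floors, generic odd far floor.**  `WeilPositivityOn a` from: K3's prime
constant, the polynomial profiles, the middle-range weight table with its per-mode checks, one far check (even) and the
far floor `∀ k ≥ m₀o` (odd), the collected
analytic facts of §21, the family-Gram box data `(G, c, hΓ)`, `θ`, and per sector ONE `PsdDyadic.checkPsdMid`
certificate with the four blockwise entry-box families printed in `hxx`, `hxβ`, `hβx`, `hββ`. -/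
theorem weilPositivityOn_of_cinf_tableG (ha : 0 < a)
    {A : ℝ} (hPA : ∀ (s : Finset ℤ) (c : ℤ → ℂ),
      -(A * ∑ n ∈ s, ‖c n‖ ^ 2) ≤ ∑ n ∈ s, ∑ m ∈ s, (conj (c n) * c m).re * primeCoeff a n m)
    -- ===== EVEN sector =====
    {Be re m₀e : ℕ} (hBe : 1 ≤ Be) (hBme : Be < m₀e) (se : Finset ℕ) (hse : ∀ q ∈ se, Even q)
    (coefe : Fin re → ℕ → ℝ) (hbe : ∀ j, ∑ q ∈ se, coefe j q * q * a ^ (q - 1) = 0)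
    -- far diagonal: floor on [Be+1, ∞), floor on [m₀e, ∞), and `d̂ ≤ d̂_A`
    -- far diagonal: a per-mode TABLE `wtabe` on the middle range (checked against `d̂_A`) and ONE far value `d₁e` (checked at `m₀e`)
    (wtabe : ℕ → ℝ) {d₀e d₁e : ℝ} (hd₀e : 0 < d₀e) (hd₀₁e : d₀e ≤ d₁e)
    (htabe : ∀ m : ℕ, Be + 1 ≤ m → m < m₀e → d₀e ≤ wtabe m ∧ wtabe m ≤
      (reDigammaQuarter (freq a m) - Real.log π) / 2 - a * (1 + weilArchDensity (2 * a)) / (π ^ 2 * m ^ 2)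
        - 1 / (8 * m) - a * (1 + weilArchDensity (2 * a)) / π ^ 2 * Real.sqrt (8 / ((Be + 1 - 1 : ℕ) : ℝ)) - A / 2)
    (hd₁e : d₁e ≤
      (reDigammaQuarter (freq a m₀e) - Real.log π) / 2 - a * (1 + weilArchDensity (2 * a)) / (π ^ 2 * m₀e ^ 2)
        - 1 / (8 * m₀e) - a * (1 + weilArchDensity (2 * a)) / π ^ 2 * Real.sqrt (8 / ((Be + 1 - 1 : ℕ) : ℝ)) - A / 2)
    -- matrix free map
    (Λ1e : Fin re → Fin (Be + 1) → ℝ) (Λ2e : Fin re → Fin re → ℝ)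
    -- collected monomial data on [m₀e, ∞)
    {ιe : Type*} [Fintype ιe] (φe : ιe → ℕ → ℝ) (we : ℕ → ℝ)
    (Prowe : ℕ → ιe → ℝ) (ρrowe : ℕ → ℝ) (hρrowe : ∀ n, 0 ≤ ρrowe n)
    (hrowe : ∀ m, m₀e ≤ m → ∀ n, n ≤ Be →
      |(if n = 0 then gramCoeff a 0 m else if m = 0 then gramCoeff a n 0
          else (gramCoeff a n m + gramCoeff a n (-(m : ℤ))) / 2)
        - (-1 : ℝ) ^ m * ∑ f, Prowe n f * φe f m| ≤ ρrowe n * we m)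
    (Pimge : ℕ → ιe → ℝ) (ρimge : ℕ → ℝ) (hρimge : ∀ q, 0 ≤ ρimge q)
    (himge : ∀ m, m₀e ≤ m → ∀ q ∈ se,
      |(weilWindowSesq a ((Icc (-a) a).indicator fun x : ℝ ↦ ((x : ℂ)) ^ q) (chi a m)).re
        - (-1 : ℝ) ^ m * ∑ f, Pimge q f * φe f m| ≤ ρimge q * we m)
    (Rtabe : Fin re → ιe → ℝ)
    (hVe : ∀ m, m₀e ≤ m → ∀ j : Fin re,
      ((if m = 0 then 1 else 2) * (Yoshida1992.fourierCoeff a m ((Icc (-a) a).indicator fun x : ℝ ↦ ∑ q ∈ se, ((coefe j q : ℝ) : ℂ) * ((x : ℂ)) ^ q)).re / Real.sqrt (2 * a)) = (-1 : ℝ) ^ m * ∑ f, Rtabe j f * φe f m)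
    -- exact middle range, weights, family Gram, θ, and a dominating Uq
    {We : ℝ} (hWe : ∀ N, ∑ m ∈ Ico m₀e N, we m ^ 2 ≤ We)
    (Ge : ιe → ιe → ℝ) (ce : ιe → ℝ)
    (hΓe : ∀ (N : ℕ) (u : ιe → ℝ), ∑ m ∈ Ico m₀e N, (∑ f, u f * φe f m) ^ 2
      ≤ (∑ f, ∑ f', u f * u f' * Ge f f') + ∑ f, u f ^ 2 * ce f)
    {θe : ℝ} (hθe : 0 < θe)
    -- margin (verbatim DoorB)
    {δe : ℝ} (hδe : 0 < δe)
    -- margin certificate: ONE `checkPsdMid` on the ((Be + 1)+re)² table `mide` (x-block first), blockwise entry boxes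
    {δZe ρZe : ℤ} {mide Le : List (List ℤ)} (hchecke : PsdDyadic.checkPsdMid ((Be + 1) + re) δZe ρZe mide Le = true)
    {ue : ℝ} (hue : 0 < ue)
    (hxxe : ∀ i i' : Fin (Be + 1), |(((if (i : ℕ) = 0 then gramCoeff a 0 (i' : ℕ) else if (i' : ℕ) = 0 then gramCoeff a (i : ℕ) 0 else (gramCoeff a (i : ℕ) (i' : ℕ) + gramCoeff a (i : ℕ) (-(((i' : ℕ)) : ℤ))) / 2)
          - ((∑ m ∈ Finset.Ico (Be + 1) m₀e,
            ((if (i : ℕ) = 0 then gramCoeff a 0 m else if m = 0 then gramCoeff a i 0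
            else (gramCoeff a i m + gramCoeff a i (-(m : ℤ))) / 2)
                  - ∑ j, ((if m = 0 then 1 else 2) * (Yoshida1992.fourierCoeff a m ((Icc (-a) a).indicator fun x : ℝ ↦ ∑ q ∈ se, ((coefe j q : ℝ) : ℂ) * ((x : ℂ)) ^ q)).re / Real.sqrt (2 * a)) * Λ1e j i)
            * ((if (i' : ℕ) = 0 then gramCoeff a 0 m else if m = 0 then gramCoeff a i' 0
            else (gramCoeff a i' m + gramCoeff a i' (-(m : ℤ))) / 2)
                  - ∑ j, ((if m = 0 then 1 else 2) * (Yoshida1992.fourierCoeff a m ((Icc (-a) a).indicator fun x : ℝ ↦ ∑ q ∈ se, ((coefe j q : ℝ) : ℂ) * ((x : ℂ)) ^ q)).re / Real.sqrt (2 * a)) * Λ1e j i') / wtabe m) + ((1 + θe) * ((∑ f, ∑ f', ((Prowe i f - ∑ j, Rtabe j f * Λ1e j i)) * ((Prowe i' f' - ∑ j, Rtabe j f' * Λ1e j i')) * Ge f f')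
              + ∑ f, ce f * ((Prowe i f - ∑ j, Rtabe j f * Λ1e j i)) * ((Prowe i' f - ∑ j, Rtabe j f * Λ1e j i')))
            + (1 + 1 / θe) * (We * ((∑ i : Fin (Be + 1), ρrowe i
                + ∑ j, (∑ q ∈ se, |coefe j q| * ρimge q
                    + ∑ n ∈ Finset.range (Be + 1), |((if n = 0 then 1 else 2) * (Yoshida1992.fourierCoeff a n ((Icc (-a) a).indicator fun x : ℝ ↦ ∑ q ∈ se, ((coefe j q : ℝ) : ℂ) * ((x : ℂ)) ^ q)).re / Real.sqrt (2 * a))| * ρrowe n))))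
              * (if i = i' then ρrowe i else 0)) / d₁e))
          - if i = i' then δe else 0) - (PsdDyadic.getMZ mide i i' : ℝ) * ue| ≤ (ρZe : ℝ) * ue)
    (hxβe : ∀ (i : Fin (Be + 1)) (j₁ : Fin re), |((((weilWindowSesq a ((Icc (-a) a).indicator fun x : ℝ ↦ ∑ q ∈ se, ((coefe j₁ q : ℝ) : ℂ) * ((x : ℂ)) ^ q) (chiEven a (i : ℕ))).re / (if (i : ℕ) = 0 then 1 else Real.sqrt 2)) - ∑ n ∈ Finset.range (Be + 1), (if n = 0 then gramCoeff a 0 (i : ℕ) else if (i : ℕ) = 0 then gramCoeff a n 0 else (gramCoeff a n (i : ℕ) + gramCoeff a n (-(((i : ℕ)) : ℤ))) / 2) * ((if n = 0 then 1 else 2) * (Yoshida1992.fourierCoeff a n ((Icc (-a) a).indicator fun x : ℝ ↦ ∑ q ∈ se, ((coefe j₁ q : ℝ) : ℂ) * ((x : ℂ)) ^ q)).re / Real.sqrt (2 * a)))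
            + (Λ1e j₁ i - ∑ j₀, Λ1e j₀ i * (2 * (∫ x, ((Icc (-a) a).indicator fun x : ℝ ↦ ∑ q ∈ se, ((coefe j₀ q : ℝ) : ℂ) * ((x : ℂ)) ^ q) x * conj (((Icc (-a) a).indicator fun x : ℝ ↦ ∑ q ∈ se, ((coefe j₁ q : ℝ) : ℂ) * ((x : ℂ)) ^ q) x)).re - 2 * (((Yoshida1992.fourierCoeff a 0 ((Icc (-a) a).indicator fun x : ℝ ↦ ∑ q ∈ se, ((coefe j₀ q : ℝ) : ℂ) * ((x : ℂ)) ^ q)).re / Real.sqrt (2 * a)) * ((Yoshida1992.fourierCoeff a 0 ((Icc (-a) a).indicator fun x : ℝ ↦ ∑ q ∈ se, ((coefe j₁ q : ℝ) : ℂ) * ((x : ℂ)) ^ q)).re / Real.sqrt (2 * a)))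
                        - ∑ n ∈ Finset.Ico 1 (Be + 1), (2 * (Yoshida1992.fourierCoeff a n ((Icc (-a) a).indicator fun x : ℝ ↦ ∑ q ∈ se, ((coefe j₀ q : ℝ) : ℂ) * ((x : ℂ)) ^ q)).re / Real.sqrt (2 * a)) * (2 * (Yoshida1992.fourierCoeff a n ((Icc (-a) a).indicator fun x : ℝ ↦ ∑ q ∈ se, ((coefe j₁ q : ℝ) : ℂ) * ((x : ℂ)) ^ q)).re / Real.sqrt (2 * a))))
          - ((∑ m ∈ Finset.Ico (Be + 1) m₀e,
            ((if (i : ℕ) = 0 then gramCoeff a 0 m else if m = 0 then gramCoeff a i 0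
            else (gramCoeff a i m + gramCoeff a i (-(m : ℤ))) / 2)
                  - ∑ j, ((if m = 0 then 1 else 2) * (Yoshida1992.fourierCoeff a m ((Icc (-a) a).indicator fun x : ℝ ↦ ∑ q ∈ se, ((coefe j q : ℝ) : ℂ) * ((x : ℂ)) ^ q)).re / Real.sqrt (2 * a)) * Λ1e j i)
            * ((((weilWindowSesq a ((Icc (-a) a).indicator fun x : ℝ ↦ ∑ q ∈ se, ((coefe j₁ q : ℝ) : ℂ) * ((x : ℂ)) ^ q) (chiEven a m)).re / (if m = 0 then 1 else Real.sqrt 2))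
                - ∑ n ∈ Finset.range (Be + 1), (if n = 0 then gramCoeff a 0 m else if m = 0 then gramCoeff a n 0 else (gramCoeff a n m + gramCoeff a n (-((m) : ℤ))) / 2) * ((if n = 0 then 1 else 2) * (Yoshida1992.fourierCoeff a n ((Icc (-a) a).indicator fun x : ℝ ↦ ∑ q ∈ se, ((coefe j₁ q : ℝ) : ℂ) * ((x : ℂ)) ^ q)).re / Real.sqrt (2 * a)))
                  - ∑ j, ((if m = 0 then 1 else 2) * (Yoshida1992.fourierCoeff a m ((Icc (-a) a).indicator fun x : ℝ ↦ ∑ q ∈ se, ((coefe j q : ℝ) : ℂ) * ((x : ℂ)) ^ q)).re / Real.sqrt (2 * a)) * Λ2e j j₁) / wtabe m) + (1 + θe) * ((∑ f, ∑ f', ((Prowe i f - ∑ j, Rtabe j f * Λ1e j i)) * ((∑ q ∈ se, coefe j₁ q * Pimge q f'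
                      - ∑ n ∈ Finset.range (Be + 1), ((if n = 0 then 1 else 2) * (Yoshida1992.fourierCoeff a n ((Icc (-a) a).indicator fun x : ℝ ↦ ∑ q ∈ se, ((coefe j₁ q : ℝ) : ℂ) * ((x : ℂ)) ^ q)).re / Real.sqrt (2 * a)) * Prowe n f')
                    - ∑ j, Rtabe j f' * Λ2e j j₁) * Ge f f')
              + ∑ f, ce f * ((Prowe i f - ∑ j, Rtabe j f * Λ1e j i)) * ((∑ q ∈ se, coefe j₁ q * Pimge q f
                      - ∑ n ∈ Finset.range (Be + 1), ((if n = 0 then 1 else 2) * (Yoshida1992.fourierCoeff a n ((Icc (-a) a).indicator fun x : ℝ ↦ ∑ q ∈ se, ((coefe j₁ q : ℝ) : ℂ) * ((x : ℂ)) ^ q)).re / Real.sqrt (2 * a)) * Prowe n f)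
                    - ∑ j, Rtabe j f * Λ2e j j₁)) / d₁e))
          - (PsdDyadic.getMZ mide i ((Be + 1) + j₁) : ℝ) * ue| ≤ (ρZe : ℝ) * ue)
    (hβxe : ∀ (j₁ : Fin re) (i : Fin (Be + 1)), |((((weilWindowSesq a ((Icc (-a) a).indicator fun x : ℝ ↦ ∑ q ∈ se, ((coefe j₁ q : ℝ) : ℂ) * ((x : ℂ)) ^ q) (chiEven a (i : ℕ))).re / (if (i : ℕ) = 0 then 1 else Real.sqrt 2)) - ∑ n ∈ Finset.range (Be + 1), (if n = 0 then gramCoeff a 0 (i : ℕ) else if (i : ℕ) = 0 then gramCoeff a n 0 else (gramCoeff a n (i : ℕ) + gramCoeff a n (-(((i : ℕ)) : ℤ))) / 2) * ((if n = 0 then 1 else 2) * (Yoshida1992.fourierCoeff a n ((Icc (-a) a).indicator fun x : ℝ ↦ ∑ q ∈ se, ((coefe j₁ q : ℝ) : ℂ) * ((x : ℂ)) ^ q)).re / Real.sqrt (2 * a)))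
            + (Λ1e j₁ i - ∑ j₀, Λ1e j₀ i * (2 * (∫ x, ((Icc (-a) a).indicator fun x : ℝ ↦ ∑ q ∈ se, ((coefe j₀ q : ℝ) : ℂ) * ((x : ℂ)) ^ q) x * conj (((Icc (-a) a).indicator fun x : ℝ ↦ ∑ q ∈ se, ((coefe j₁ q : ℝ) : ℂ) * ((x : ℂ)) ^ q) x)).re - 2 * (((Yoshida1992.fourierCoeff a 0 ((Icc (-a) a).indicator fun x : ℝ ↦ ∑ q ∈ se, ((coefe j₀ q : ℝ) : ℂ) * ((x : ℂ)) ^ q)).re / Real.sqrt (2 * a)) * ((Yoshida1992.fourierCoeff a 0 ((Icc (-a) a).indicator fun x : ℝ ↦ ∑ q ∈ se, ((coefe j₁ q : ℝ) : ℂ) * ((x : ℂ)) ^ q)).re / Real.sqrt (2 * a)))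
                        - ∑ n ∈ Finset.Ico 1 (Be + 1), (2 * (Yoshida1992.fourierCoeff a n ((Icc (-a) a).indicator fun x : ℝ ↦ ∑ q ∈ se, ((coefe j₀ q : ℝ) : ℂ) * ((x : ℂ)) ^ q)).re / Real.sqrt (2 * a)) * (2 * (Yoshida1992.fourierCoeff a n ((Icc (-a) a).indicator fun x : ℝ ↦ ∑ q ∈ se, ((coefe j₁ q : ℝ) : ℂ) * ((x : ℂ)) ^ q)).re / Real.sqrt (2 * a))))
          - ((∑ m ∈ Finset.Ico (Be + 1) m₀e,
            ((((weilWindowSesq a ((Icc (-a) a).indicator fun x : ℝ ↦ ∑ q ∈ se, ((coefe j₁ q : ℝ) : ℂ) * ((x : ℂ)) ^ q) (chiEven a m)).re / (if m = 0 then 1 else Real.sqrt 2))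
                - ∑ n ∈ Finset.range (Be + 1), (if n = 0 then gramCoeff a 0 m else if m = 0 then gramCoeff a n 0 else (gramCoeff a n m + gramCoeff a n (-((m) : ℤ))) / 2) * ((if n = 0 then 1 else 2) * (Yoshida1992.fourierCoeff a n ((Icc (-a) a).indicator fun x : ℝ ↦ ∑ q ∈ se, ((coefe j₁ q : ℝ) : ℂ) * ((x : ℂ)) ^ q)).re / Real.sqrt (2 * a)))
                  - ∑ j, ((if m = 0 then 1 else 2) * (Yoshida1992.fourierCoeff a m ((Icc (-a) a).indicator fun x : ℝ ↦ ∑ q ∈ se, ((coefe j q : ℝ) : ℂ) * ((x : ℂ)) ^ q)).re / Real.sqrt (2 * a)) * Λ2e j j₁)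
            * ((if (i : ℕ) = 0 then gramCoeff a 0 m else if m = 0 then gramCoeff a i 0
            else (gramCoeff a i m + gramCoeff a i (-(m : ℤ))) / 2)
                  - ∑ j, ((if m = 0 then 1 else 2) * (Yoshida1992.fourierCoeff a m ((Icc (-a) a).indicator fun x : ℝ ↦ ∑ q ∈ se, ((coefe j q : ℝ) : ℂ) * ((x : ℂ)) ^ q)).re / Real.sqrt (2 * a)) * Λ1e j i) / wtabe m) + (1 + θe) * ((∑ f, ∑ f', ((∑ q ∈ se, coefe j₁ q * Pimge q f
                      - ∑ n ∈ Finset.range (Be + 1), ((if n = 0 then 1 else 2) * (Yoshida1992.fourierCoeff a n ((Icc (-a) a).indicator fun x : ℝ ↦ ∑ q ∈ se, ((coefe j₁ q : ℝ) : ℂ) * ((x : ℂ)) ^ q)).re / Real.sqrt (2 * a)) * Prowe n f)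
                    - ∑ j, Rtabe j f * Λ2e j j₁) * ((Prowe i f' - ∑ j, Rtabe j f' * Λ1e j i)) * Ge f f')
              + ∑ f, ce f * ((∑ q ∈ se, coefe j₁ q * Pimge q f
                      - ∑ n ∈ Finset.range (Be + 1), ((if n = 0 then 1 else 2) * (Yoshida1992.fourierCoeff a n ((Icc (-a) a).indicator fun x : ℝ ↦ ∑ q ∈ se, ((coefe j₁ q : ℝ) : ℂ) * ((x : ℂ)) ^ q)).re / Real.sqrt (2 * a)) * Prowe n f)
                    - ∑ j, Rtabe j f * Λ2e j j₁) * ((Prowe i f - ∑ j, Rtabe j f * Λ1e j i))) / d₁e))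
          - (PsdDyadic.getMZ mide ((Be + 1) + j₁) i : ℝ) * ue| ≤ (ρZe : ℝ) * ue)
    (hββe : ∀ j₁ j₂ : Fin re, |((((weilWindowSesq a ((Icc (-a) a).indicator fun x : ℝ ↦ ∑ q ∈ se, ((coefe j₁ q : ℝ) : ℂ) * ((x : ℂ)) ^ q) ((Icc (-a) a).indicator fun x : ℝ ↦ ∑ q ∈ se, ((coefe j₂ q : ℝ) : ℂ) * ((x : ℂ)) ^ q)).re
                      - ∑ n ∈ Finset.range (Be + 1), ((if n = 0 then 1 else 2) * (Yoshida1992.fourierCoeff a n ((Icc (-a) a).indicator fun x : ℝ ↦ ∑ q ∈ se, ((coefe j₂ q : ℝ) : ℂ) * ((x : ℂ)) ^ q)).re / Real.sqrt (2 * a)) * ((weilWindowSesq a ((Icc (-a) a).indicator fun x : ℝ ↦ ∑ q ∈ se, ((coefe j₁ q : ℝ) : ℂ) * ((x : ℂ)) ^ q) (chiEven a n)).re / (if n = 0 then 1 else Real.sqrt 2))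
                      - ∑ n ∈ Finset.range (Be + 1), ((if n = 0 then 1 else 2) * (Yoshida1992.fourierCoeff a n ((Icc (-a) a).indicator fun x : ℝ ↦ ∑ q ∈ se, ((coefe j₁ q : ℝ) : ℂ) * ((x : ℂ)) ^ q)).re / Real.sqrt (2 * a)) * ((weilWindowSesq a ((Icc (-a) a).indicator fun x : ℝ ↦ ∑ q ∈ se, ((coefe j₂ q : ℝ) : ℂ) * ((x : ℂ)) ^ q) (chiEven a n)).re / (if n = 0 then 1 else Real.sqrt 2))
                      + ∑ n ∈ Finset.range (Be + 1), ((if n = 0 then 1 else 2) * (Yoshida1992.fourierCoeff a n ((Icc (-a) a).indicator fun x : ℝ ↦ ∑ q ∈ se, ((coefe j₂ q : ℝ) : ℂ) * ((x : ℂ)) ^ q)).re / Real.sqrt (2 * a)) * ∑ n' ∈ Finset.range (Be + 1), (if n' = 0 then gramCoeff a 0 n else if n = 0 then gramCoeff a n' 0 else (gramCoeff a n' n + gramCoeff a n' (-((n) : ℤ))) / 2) * ((if n' = 0 then 1 else 2) * (Yoshida1992.fourierCoeff a n' ((Icc (-a) a).indicator fun x : ℝ ↦ ∑ q ∈ se,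 ((coefe j₁ q : ℝ) : ℂ) * ((x : ℂ)) ^ q)).re / Real.sqrt (2 * a)))
            + (Λ2e j₂ j₁ + Λ2e j₁ j₂ - ∑ j₀, Λ2e j₀ j₁ * (2 * (∫ x, ((Icc (-a) a).indicator fun x : ℝ ↦ ∑ q ∈ se, ((coefe j₀ q : ℝ) : ℂ) * ((x : ℂ)) ^ q) x * conj (((Icc (-a) a).indicator fun x : ℝ ↦ ∑ q ∈ se, ((coefe j₂ q : ℝ) : ℂ) * ((x : ℂ)) ^ q) x)).re - 2 * (((Yoshida1992.fourierCoeff a 0 ((Icc (-a) a).indicator fun x : ℝ ↦ ∑ q ∈ se, ((coefe j₀ q : ℝ) : ℂ) * ((x : ℂ)) ^ q)).re / Real.sqrt (2 * a)) * ((Yoshida1992.fourierCoeff a 0 ((Icc (-a) a).indicator fun x : ℝ ↦ ∑ q ∈ se, ((coefe j₂ q : ℝ) : ℂ) * ((x : ℂ)) ^ q)).re / Real.sqrt (2 * a)))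
                        - ∑ n ∈ Finset.Ico 1 (Be + 1), (2 * (Yoshida1992.fourierCoeff a n ((Icc (-a) a).indicator fun x : ℝ ↦ ∑ q ∈ se, ((coefe j₀ q : ℝ) : ℂ) * ((x : ℂ)) ^ q)).re / Real.sqrt (2 * a)) * (2 * (Yoshida1992.fourierCoeff a n ((Icc (-a) a).indicator fun x : ℝ ↦ ∑ q ∈ se, ((coefe j₂ q : ℝ) : ℂ) * ((x : ℂ)) ^ q)).re / Real.sqrt (2 * a))) - ∑ j₀, Λ2e j₀ j₂ * (2 * (∫ x, ((Icc (-a) a).indicator fun x : ℝ ↦ ∑ q ∈ se, ((coefe j₀ q : ℝ) : ℂ) * ((x : ℂ)) ^ q) x * conj (((Icc (-a) a).indicator fun x : ℝ ↦ ∑ q ∈ se, ((coefe j₁ q : ℝ) : ℂ) * ((x : ℂ)) ^ q) x)).re - 2 * (((Yoshida1992.fourierCoeff a 0 ((Icc (-a) a).indicator fun x : ℝ ↦ ∑ q ∈ se, ((coefe j₀ q : ℝ) : ℂ) * ((x : ℂ)) ^ q)).re / Real.sqrt (2 * a)) * ((Yoshida1992.fourierCoeff a 0 ((Icc (-a) a).indicator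 fun x : ℝ ↦ ∑ q ∈ se, ((coefe j₁ q : ℝ) : ℂ) * ((x : ℂ)) ^ q)).re / Real.sqrt (2 * a)))
                        - ∑ n ∈ Finset.Ico 1 (Be + 1), (2 * (Yoshida1992.fourierCoeff a n ((Icc (-a) a).indicator fun x : ℝ ↦ ∑ q ∈ se, ((coefe j₀ q : ℝ) : ℂ) * ((x : ℂ)) ^ q)).re / Real.sqrt (2 * a)) * (2 * (Yoshida1992.fourierCoeff a n ((Icc (-a) a).indicator fun x : ℝ ↦ ∑ q ∈ se, ((coefe j₁ q : ℝ) : ℂ) * ((x : ℂ)) ^ q)).re / Real.sqrt (2 * a))))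
          - ((∑ m ∈ Finset.Ico (Be + 1) m₀e,
            ((((weilWindowSesq a ((Icc (-a) a).indicator fun x : ℝ ↦ ∑ q ∈ se, ((coefe j₁ q : ℝ) : ℂ) * ((x : ℂ)) ^ q) (chiEven a m)).re / (if m = 0 then 1 else Real.sqrt 2))
                - ∑ n ∈ Finset.range (Be + 1), (if n = 0 then gramCoeff a 0 m else if m = 0 then gramCoeff a n 0 else (gramCoeff a n m + gramCoeff a n (-((m) : ℤ))) / 2) * ((if n = 0 then 1 else 2) * (Yoshida1992.fourierCoeff a n ((Icc (-a) a).indicator fun x : ℝ ↦ ∑ q ∈ se, ((coefe j₁ q : ℝ) : ℂ) * ((x : ℂ)) ^ q)).re / Real.sqrt (2 * a)))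
                  - ∑ j, ((if m = 0 then 1 else 2) * (Yoshida1992.fourierCoeff a m ((Icc (-a) a).indicator fun x : ℝ ↦ ∑ q ∈ se, ((coefe j q : ℝ) : ℂ) * ((x : ℂ)) ^ q)).re / Real.sqrt (2 * a)) * Λ2e j j₁)
            * ((((weilWindowSesq a ((Icc (-a) a).indicator fun x : ℝ ↦ ∑ q ∈ se, ((coefe j₂ q : ℝ) : ℂ) * ((x : ℂ)) ^ q) (chiEven a m)).re / (if m = 0 then 1 else Real.sqrt 2))
                - ∑ n ∈ Finset.range (Be + 1), (if n = 0 then gramCoeff a 0 m else if m = 0 then gramCoeff a n 0 else (gramCoeff a n m + gramCoeff a n (-((m) : ℤ))) / 2) * ((if n = 0 then 1 else 2) * (Yoshida1992.fourierCoeff a n ((Icc (-a) a).indicator fun x : ℝ ↦ ∑ q ∈ se, ((coefe j₂ q : ℝ) : ℂ) * ((x : ℂ)) ^ q)).re / Real.sqrt (2 * a)))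
                  - ∑ j, ((if m = 0 then 1 else 2) * (Yoshida1992.fourierCoeff a m ((Icc (-a) a).indicator fun x : ℝ ↦ ∑ q ∈ se, ((coefe j q : ℝ) : ℂ) * ((x : ℂ)) ^ q)).re / Real.sqrt (2 * a)) * Λ2e j j₂) / wtabe m) + ((1 + θe) * ((∑ f, ∑ f', ((∑ q ∈ se, coefe j₁ q * Pimge q f
                      - ∑ n ∈ Finset.range (Be + 1), ((if n = 0 then 1 else 2) * (Yoshida1992.fourierCoeff a n ((Icc (-a) a).indicator fun x : ℝ ↦ ∑ q ∈ se, ((coefe j₁ q : ℝ) : ℂ) * ((x : ℂ)) ^ q)).re / Real.sqrt (2 * a)) * Prowe n f)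
                    - ∑ j, Rtabe j f * Λ2e j j₁) * ((∑ q ∈ se, coefe j₂ q * Pimge q f'
                      - ∑ n ∈ Finset.range (Be + 1), ((if n = 0 then 1 else 2) * (Yoshida1992.fourierCoeff a n ((Icc (-a) a).indicator fun x : ℝ ↦ ∑ q ∈ se, ((coefe j₂ q : ℝ) : ℂ) * ((x : ℂ)) ^ q)).re / Real.sqrt (2 * a)) * Prowe n f')
                    - ∑ j, Rtabe j f' * Λ2e j j₂) * Ge f f')
              + ∑ f, ce f * ((∑ q ∈ se, coefe j₁ q * Pimge q f
                      - ∑ n ∈ Finset.range (Be + 1), ((if n = 0 then 1 else 2) * (Yoshida1992.fourierCoeff a n ((Icc (-a) a).indicator fun x : ℝ ↦ ∑ q ∈ se, ((coefe j₁ q : ℝ) : ℂ) * ((x : ℂ)) ^ q)).re / Real.sqrt (2 * a)) * Prowe n f)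
                    - ∑ j, Rtabe j f * Λ2e j j₁) * ((∑ q ∈ se, coefe j₂ q * Pimge q f
                      - ∑ n ∈ Finset.range (Be + 1), ((if n = 0 then 1 else 2) * (Yoshida1992.fourierCoeff a n ((Icc (-a) a).indicator fun x : ℝ ↦ ∑ q ∈ se, ((coefe j₂ q : ℝ) : ℂ) * ((x : ℂ)) ^ q)).re / Real.sqrt (2 * a)) * Prowe n f)
                    - ∑ j, Rtabe j f * Λ2e j j₂))
            + (1 + 1 / θe) * (We * ((∑ i : Fin (Be + 1), ρrowe i
                + ∑ j, (∑ q ∈ se, |coefe j q| * ρimge q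
                    + ∑ n ∈ Finset.range (Be + 1), |((if n = 0 then 1 else 2) * (Yoshida1992.fourierCoeff a n ((Icc (-a) a).indicator fun x : ℝ ↦ ∑ q ∈ se, ((coefe j q : ℝ) : ℂ) * ((x : ℂ)) ^ q)).re / Real.sqrt (2 * a))| * ρrowe n))))
              * (if j₁ = j₂ then (∑ q ∈ se, |coefe j₁ q| * ρimge q
                    + ∑ n ∈ Finset.range (Be + 1), |((if n = 0 then 1 else 2) * (Yoshida1992.fourierCoeff a n ((Icc (-a) a).indicator fun x : ℝ ↦ ∑ q ∈ se, ((coefe j₁ q : ℝ) : ℂ) * ((x : ℂ)) ^ q)).re / Real.sqrt (2 * a))| * ρrowe n) else 0)) / d₁e))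
          - if j₁ = j₂ then δe else 0) - (PsdDyadic.getMZ mide ((Be + 1) + j₁) ((Be + 1) + j₂) : ℝ) * ue| ≤ (ρZe : ℝ) * ue)
    -- ===== ODD sector =====
    {Bo ro m₀o : ℕ} (hBo : 1 ≤ Bo) (hBmo : Bo ≤ m₀o) (so : Finset ℕ) (hso : ∀ q ∈ so, Odd q)
    (coefo : Fin ro → ℕ → ℝ) (hbo : ∀ j, ∑ q ∈ so, coefo j q * a ^ q = 0)
    (wtabo : ℕ → ℝ) {d₀o d₁o : ℝ} (hd₀o : 0 < d₀o) (hd₀₁o : d₀o ≤ d₁o)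
    (htabo : ∀ k : ℕ, Bo ≤ k → k < m₀o → d₀o ≤ wtabo k ∧ wtabo k ≤
      (reDigammaQuarter (freq a ((k : ℤ) + 1)) - Real.log π) / 2 - 1 / (8 * ((k : ℝ) + 1))
        - a * (1 + weilArchDensity (2 * a)) / (π ^ 2 * ((k : ℝ) + 1) ^ 2)
        - (π / 2 - Real.arctan (Real.sqrt Bo / Real.sqrt ((k : ℝ) + 1))) / 2
        - a * (1 + weilArchDensity (2 * a)) / π ^ 2 * Real.sqrt (8 / Bo)
        - A / 2
        - (Real.exp (a / 2) - Real.exp (-(a / 2))) ^ 2 * a / (π ^ 2 * Bo))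
    (hfaro : ∀ k : ℕ, m₀o ≤ k → d₁o ≤
      (reDigammaQuarter (freq a ((k : ℤ) + 1)) - Real.log π) / 2 - 1 / (8 * ((k : ℝ) + 1))
        - a * (1 + weilArchDensity (2 * a)) / (π ^ 2 * ((k : ℝ) + 1) ^ 2)
        - (π / 2 - Real.arctan (Real.sqrt Bo / Real.sqrt ((k : ℝ) + 1))) / 2
        - a * (1 + weilArchDensity (2 * a)) / π ^ 2 * Real.sqrt (8 / Bo)
        - A / 2
        - (Real.exp (a / 2) - Real.exp (-(a / 2))) ^ 2 * a / (π ^ 2 * Bo))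
    (Λ1o : Fin ro → Fin Bo → ℝ) (Λ2o : Fin ro → Fin ro → ℝ)
    {ιo : Type*} [Fintype ιo] (φo : ιo → ℕ → ℝ) (wo : ℕ → ℝ)
    (Prowo : ℕ → ιo → ℝ) (ρrowo : ℕ → ℝ) (hρrowo : ∀ k, 0 ≤ ρrowo k)
    (hrowo : ∀ m, m₀o ≤ m → ∀ k, k < Bo →
      |((gramCoeff a ((k + 1 : ℕ) : ℤ) ((m + 1 : ℕ) : ℤ) - gramCoeff a ((k + 1 : ℕ) : ℤ) (-((m + 1 : ℕ) : ℤ))) / 2)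
        - (-1 : ℝ) ^ (m + 1) * ∑ f, Prowo k f * φo f m| ≤ ρrowo k * wo m)
    (Pimgo : ℕ → ιo → ℝ) (ρimgo : ℕ → ℝ) (hρimgo : ∀ q, 0 ≤ ρimgo q)
    (himgo : ∀ m, m₀o ≤ m → ∀ q ∈ so,
      |(weilWindowSesq a ((Icc (-a) a).indicator fun x : ℝ ↦ ((x : ℂ)) ^ q) (chi a (m + 1))).im
        - (-1 : ℝ) ^ (m + 1) * ∑ f, Pimgo q f * φo f m| ≤ ρimgo q * wo m)
    (Rtabo : Fin ro → ιo → ℝ)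
    (hVo : ∀ m, m₀o ≤ m → ∀ j : Fin ro,
      (2 * (Yoshida1992.fourierCoeff a ((m + 1 : ℕ) : ℤ) ((Icc (-a) a).indicator fun x : ℝ ↦ ∑ q ∈ so, ((coefo j q : ℝ) : ℂ) * ((x : ℂ)) ^ q)).im / Real.sqrt (2 * a))
        = (-1 : ℝ) ^ (m + 1) * ∑ f, Rtabo j f * φo f m)
    {Wo : ℝ} (hWo : ∀ N, ∑ m ∈ Ico m₀o N, wo m ^ 2 ≤ Wo)
    (Go : ιo → ιo → ℝ) (co : ιo → ℝ)
    (hΓo : ∀ (N : ℕ) (u : ιo → ℝ), ∑ m ∈ Ico m₀o N, (∑ f, u f * φo f m) ^ 2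
      ≤ (∑ f, ∑ f', u f * u f' * Go f f') + ∑ f, u f ^ 2 * co f)
    {θo : ℝ} (hθo : 0 < θo)
    {δo : ℝ} (hδo : 0 < δo)
    -- margin certificate: ONE `checkPsdMid` on the (Bo+ro)² table `mido` (x-block first), blockwise entry boxes
    {δZo ρZo : ℤ} {mido Lo : List (List ℤ)} (hchecko : PsdDyadic.checkPsdMid (Bo + ro) δZo ρZo mido Lo = true)
    {uo : ℝ} (huo : 0 < uo)
    (hxxo : ∀ i i' : Fin Bo, |((((gramCoeff a (((i : ℕ) : ℤ) + 1) (((i' : ℕ) : ℤ) + 1) - gramCoeff a (((i : ℕ) : ℤ) + 1) (-((((i' : ℕ) : ℤ)) + 1))) / 2)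
          - ((∑ m ∈ Finset.Ico Bo m₀o,
            (((gramCoeff a (((i : ℕ) : ℤ) + 1) ((m : ℤ) + 1) - gramCoeff a (((i : ℕ) : ℤ) + 1) (-((m : ℤ) + 1))) / 2)
                  - ∑ j, (2 * (Yoshida1992.fourierCoeff a ((m : ℤ) + 1) ((Icc (-a) a).indicator fun x : ℝ ↦ ∑ q ∈ so, ((coefo j q : ℝ) : ℂ) * ((x : ℂ)) ^ q)).im / Real.sqrt (2 * a)) * Λ1o j i)
            * (((gramCoeff a (((i' : ℕ) : ℤ) + 1) ((m : ℤ) + 1) - gramCoeff a (((i' : ℕ) : ℤ) + 1) (-((m : ℤ) + 1))) / 2)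
                  - ∑ j, (2 * (Yoshida1992.fourierCoeff a ((m : ℤ) + 1) ((Icc (-a) a).indicator fun x : ℝ ↦ ∑ q ∈ so, ((coefo j q : ℝ) : ℂ) * ((x : ℂ)) ^ q)).im / Real.sqrt (2 * a)) * Λ1o j i') / wtabo m) + ((1 + θo) * ((∑ f, ∑ f', ((Prowo i f - ∑ j, Rtabo j f * Λ1o j i)) * ((Prowo i' f' - ∑ j, Rtabo j f' * Λ1o j i')) * Go f f')
              + ∑ f, co f * ((Prowo i f - ∑ j, Rtabo j f * Λ1o j i)) * ((Prowo i' f - ∑ j, Rtabo j f * Λ1o j i')))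
            + (1 + 1 / θo) * (Wo * ((∑ i : Fin Bo, ρrowo i
                + ∑ j, (∑ q ∈ so, |coefo j q| * ρimgo q
                    + ∑ n ∈ Finset.Ico 0 Bo, |(2 * (Yoshida1992.fourierCoeff a ((n : ℤ) + 1) ((Icc (-a) a).indicator fun x : ℝ ↦ ∑ q ∈ so, ((coefo j q : ℝ) : ℂ) * ((x : ℂ)) ^ q)).im / Real.sqrt (2 * a))| * ρrowo n))))
              * (if i = i' then ρrowo i else 0)) / d₁o))
          - if i = i' then δo else 0) - (PsdDyadic.getMZ mido i i' : ℝ) * uo| ≤ (ρZo : ℝ) * uo)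
    (hxβo : ∀ (i : Fin Bo) (j₁ : Fin ro), |((((weilWindowSesq a ((Icc (-a) a).indicator fun x : ℝ ↦ ∑ q ∈ so, ((coefo j₁ q : ℝ) : ℂ) * ((x : ℂ)) ^ q) (chiOdd a ((i : ℕ) + 1))).im / Real.sqrt 2) - ∑ k ∈ Finset.Ico 0 Bo, ((gramCoeff a ((k : ℤ) + 1) (((i : ℕ) : ℤ) + 1) - gramCoeff a ((k : ℤ) + 1) (-(((i : ℕ) : ℤ) + 1))) / 2) * (2 * (Yoshida1992.fourierCoeff a ((k : ℤ) + 1) ((Icc (-a) a).indicator fun x : ℝ ↦ ∑ q ∈ so, ((coefo j₁ q : ℝ) : ℂ) * ((x : ℂ)) ^ q)).im / Real.sqrt (2 * a)))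
            + (Λ1o j₁ i - ∑ j₀, Λ1o j₀ i * (2 * (∫ x, ((Icc (-a) a).indicator fun x : ℝ ↦ ∑ q ∈ so, ((coefo j₀ q : ℝ) : ℂ) * ((x : ℂ)) ^ q) x * conj (((Icc (-a) a).indicator fun x : ℝ ↦ ∑ q ∈ so, ((coefo j₁ q : ℝ) : ℂ) * ((x : ℂ)) ^ q) x)).re
                        - ∑ k ∈ Finset.range Bo, (2 * (Yoshida1992.fourierCoeff a ((k : ℤ) + 1) ((Icc (-a) a).indicator fun x : ℝ ↦ ∑ q ∈ so, ((coefo j₀ q : ℝ) : ℂ) * ((x : ℂ)) ^ q)).im / Real.sqrt (2 * a)) * (2 * (Yoshida1992.fourierCoeff a ((k : ℤ) + 1) ((Icc (-a) a).indicator fun x : ℝ ↦ ∑ q ∈ so, ((coefo j₁ q : ℝ) : ℂ) * ((x : ℂ)) ^ q)).im / Real.sqrt (2 * a))))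
          - ((∑ m ∈ Finset.Ico Bo m₀o,
            (((gramCoeff a (((i : ℕ) : ℤ) + 1) ((m : ℤ) + 1) - gramCoeff a (((i : ℕ) : ℤ) + 1) (-((m : ℤ) + 1))) / 2)
                  - ∑ j, (2 * (Yoshida1992.fourierCoeff a ((m : ℤ) + 1) ((Icc (-a) a).indicator fun x : ℝ ↦ ∑ q ∈ so, ((coefo j q : ℝ) : ℂ) * ((x : ℂ)) ^ q)).im / Real.sqrt (2 * a)) * Λ1o j i)
            * ((((weilWindowSesq a ((Icc (-a) a).indicator fun x : ℝ ↦ ∑ q ∈ so, ((coefo j₁ q : ℝ) : ℂ) * ((x : ℂ)) ^ q) (chiOdd a (m + 1))).im / Real.sqrt 2)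
                - ∑ k ∈ Finset.Ico 0 Bo, ((gramCoeff a ((k : ℤ) + 1) ((m : ℤ) + 1) - gramCoeff a ((k : ℤ) + 1) (-((m : ℤ) + 1))) / 2) * (2 * (Yoshida1992.fourierCoeff a ((k : ℤ) + 1) ((Icc (-a) a).indicator fun x : ℝ ↦ ∑ q ∈ so, ((coefo j₁ q : ℝ) : ℂ) * ((x : ℂ)) ^ q)).im / Real.sqrt (2 * a)))
                  - ∑ j, (2 * (Yoshida1992.fourierCoeff a ((m : ℤ) + 1) ((Icc (-a) a).indicator fun x : ℝ ↦ ∑ q ∈ so, ((coefo j q : ℝ) : ℂ) * ((x : ℂ)) ^ q)).im / Real.sqrt (2 * a)) * Λ2o j j₁) / wtabo m) + (1 + θo) * ((∑ f, ∑ f', ((Prowo i f - ∑ j, Rtabo j f * Λ1o j i)) * ((∑ q ∈ so, coefo j₁ q * Pimgo q f'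
                      - ∑ n ∈ Finset.Ico 0 Bo, (2 * (Yoshida1992.fourierCoeff a ((n : ℤ) + 1) ((Icc (-a) a).indicator fun x : ℝ ↦ ∑ q ∈ so, ((coefo j₁ q : ℝ) : ℂ) * ((x : ℂ)) ^ q)).im / Real.sqrt (2 * a)) * Prowo n f')
                    - ∑ j, Rtabo j f' * Λ2o j j₁) * Go f f')
              + ∑ f, co f * ((Prowo i f - ∑ j, Rtabo j f * Λ1o j i)) * ((∑ q ∈ so, coefo j₁ q * Pimgo q f
                      - ∑ n ∈ Finset.Ico 0 Bo, (2 * (Yoshida1992.fourierCoeff a ((n : ℤ) + 1) ((Icc (-a) a).indicator fun x : ℝ ↦ ∑ q ∈ so, ((coefo j₁ q : ℝ) : ℂ) * ((x : ℂ)) ^ q)).im / Real.sqrt (2 * a)) * Prowo n f)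
                    - ∑ j, Rtabo j f * Λ2o j j₁)) / d₁o))
          - (PsdDyadic.getMZ mido i (Bo + j₁) : ℝ) * uo| ≤ (ρZo : ℝ) * uo)
    (hβxo : ∀ (j₁ : Fin ro) (i : Fin Bo), |((((weilWindowSesq a ((Icc (-a) a).indicator fun x : ℝ ↦ ∑ q ∈ so, ((coefo j₁ q : ℝ) : ℂ) * ((x : ℂ)) ^ q) (chiOdd a ((i : ℕ) + 1))).im / Real.sqrt 2) - ∑ k ∈ Finset.Ico 0 Bo, ((gramCoeff a ((k : ℤ) + 1) (((i : ℕ) : ℤ) + 1) - gramCoeff a ((k : ℤ) + 1) (-(((i : ℕ) : ℤ) + 1))) / 2) * (2 * (Yoshida1992.fourierCoeff a ((k : ℤ) + 1) ((Icc (-a) a).indicator fun x : ℝ ↦ ∑ q ∈ so, ((coefo j₁ q : ℝ) : ℂ) * ((x : ℂ)) ^ q)).im / Real.sqrt (2 * a)))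
            + (Λ1o j₁ i - ∑ j₀, Λ1o j₀ i * (2 * (∫ x, ((Icc (-a) a).indicator fun x : ℝ ↦ ∑ q ∈ so, ((coefo j₀ q : ℝ) : ℂ) * ((x : ℂ)) ^ q) x * conj (((Icc (-a) a).indicator fun x : ℝ ↦ ∑ q ∈ so, ((coefo j₁ q : ℝ) : ℂ) * ((x : ℂ)) ^ q) x)).re
                        - ∑ k ∈ Finset.range Bo, (2 * (Yoshida1992.fourierCoeff a ((k : ℤ) + 1) ((Icc (-a) a).indicator fun x : ℝ ↦ ∑ q ∈ so, ((coefo j₀ q : ℝ) : ℂ) * ((x : ℂ)) ^ q)).im / Real.sqrt (2 * a)) * (2 * (Yoshida1992.fourierCoeff a ((k : ℤ) + 1) ((Icc (-a) a).indicator fun x : ℝ ↦ ∑ q ∈ so, ((coefo j₁ q : ℝ) : ℂ) * ((x : ℂ)) ^ q)).im / Real.sqrt (2 * a))))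
          - ((∑ m ∈ Finset.Ico Bo m₀o,
            ((((weilWindowSesq a ((Icc (-a) a).indicator fun x : ℝ ↦ ∑ q ∈ so, ((coefo j₁ q : ℝ) : ℂ) * ((x : ℂ)) ^ q) (chiOdd a (m + 1))).im / Real.sqrt 2)
                - ∑ k ∈ Finset.Ico 0 Bo, ((gramCoeff a ((k : ℤ) + 1) ((m : ℤ) + 1) - gramCoeff a ((k : ℤ) + 1) (-((m : ℤ) + 1))) / 2) * (2 * (Yoshida1992.fourierCoeff a ((k : ℤ) + 1) ((Icc (-a) a).indicator fun x : ℝ ↦ ∑ q ∈ so, ((coefo j₁ q : ℝ) : ℂ) * ((x : ℂ)) ^ q)).im / Real.sqrt (2 * a)))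
                  - ∑ j, (2 * (Yoshida1992.fourierCoeff a ((m : ℤ) + 1) ((Icc (-a) a).indicator fun x : ℝ ↦ ∑ q ∈ so, ((coefo j q : ℝ) : ℂ) * ((x : ℂ)) ^ q)).im / Real.sqrt (2 * a)) * Λ2o j j₁)
            * (((gramCoeff a (((i : ℕ) : ℤ) + 1) ((m : ℤ) + 1) - gramCoeff a (((i : ℕ) : ℤ) + 1) (-((m : ℤ) + 1))) / 2)
                  - ∑ j, (2 * (Yoshida1992.fourierCoeff a ((m : ℤ) + 1) ((Icc (-a) a).indicator fun x : ℝ ↦ ∑ q ∈ so, ((coefo j q : ℝ) : ℂ) * ((x : ℂ)) ^ q)).im / Real.sqrt (2 * a)) * Λ1o j i) / wtabo m) + (1 + θo) * ((∑ f, ∑ f', ((∑ q ∈ so, coefo j₁ q * Pimgo q f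
                      - ∑ n ∈ Finset.Ico 0 Bo, (2 * (Yoshida1992.fourierCoeff a ((n : ℤ) + 1) ((Icc (-a) a).indicator fun x : ℝ ↦ ∑ q ∈ so, ((coefo j₁ q : ℝ) : ℂ) * ((x : ℂ)) ^ q)).im / Real.sqrt (2 * a)) * Prowo n f)
                    - ∑ j, Rtabo j f * Λ2o j j₁) * ((Prowo i f' - ∑ j, Rtabo j f' * Λ1o j i)) * Go f f')
              + ∑ f, co f * ((∑ q ∈ so, coefo j₁ q * Pimgo q f
                      - ∑ n ∈ Finset.Ico 0 Bo, (2 * (Yoshida1992.fourierCoeff a ((n : ℤ) + 1) ((Icc (-a) a).indicator fun x : ℝ ↦ ∑ q ∈ so, ((coefo j₁ q : ℝ) : ℂ) * ((x : ℂ)) ^ q)).im / Real.sqrt (2 * a)) * Prowo n f)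
                    - ∑ j, Rtabo j f * Λ2o j j₁) * ((Prowo i f - ∑ j, Rtabo j f * Λ1o j i))) / d₁o))
          - (PsdDyadic.getMZ mido (Bo + j₁) i : ℝ) * uo| ≤ (ρZo : ℝ) * uo)
    (hββo : ∀ j₁ j₂ : Fin ro, |((((weilWindowSesq a ((Icc (-a) a).indicator fun x : ℝ ↦ ∑ q ∈ so, ((coefo j₁ q : ℝ) : ℂ) * ((x : ℂ)) ^ q) ((Icc (-a) a).indicator fun x : ℝ ↦ ∑ q ∈ so, ((coefo j₂ q : ℝ) : ℂ) * ((x : ℂ)) ^ q)).re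
                      - ∑ k ∈ Finset.Ico 0 Bo, (2 * (Yoshida1992.fourierCoeff a ((k : ℤ) + 1) ((Icc (-a) a).indicator fun x : ℝ ↦ ∑ q ∈ so, ((coefo j₂ q : ℝ) : ℂ) * ((x : ℂ)) ^ q)).im / Real.sqrt (2 * a)) * ((weilWindowSesq a ((Icc (-a) a).indicator fun x : ℝ ↦ ∑ q ∈ so, ((coefo j₁ q : ℝ) : ℂ) * ((x : ℂ)) ^ q) (chiOdd a (k + 1))).im / Real.sqrt 2)
                      - ∑ k ∈ Finset.Ico 0 Bo, (2 * (Yoshida1992.fourierCoeff a ((k : ℤ) + 1) ((Icc (-a) a).indicator fun x : ℝ ↦ ∑ q ∈ so, ((coefo j₁ q : ℝ) : ℂ) * ((x : ℂ)) ^ q)).im / Real.sqrt (2 * a)) * ((weilWindowSesq a ((Icc (-a) a).indicator fun x : ℝ ↦ ∑ q ∈ so, ((coefo j₂ q : ℝ) : ℂ) * ((x : ℂ)) ^ q) (chiOdd a (k + 1))).im / Real.sqrt 2)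
                      + ∑ k ∈ Finset.Ico 0 Bo, (2 * (Yoshida1992.fourierCoeff a ((k : ℤ) + 1) ((Icc (-a) a).indicator fun x : ℝ ↦ ∑ q ∈ so, ((coefo j₂ q : ℝ) : ℂ) * ((x : ℂ)) ^ q)).im / Real.sqrt (2 * a)) * ∑ k' ∈ Finset.Ico 0 Bo, ((gramCoeff a ((k' : ℤ) + 1) ((k : ℤ) + 1) - gramCoeff a ((k' : ℤ) + 1) (-((k : ℤ) + 1))) / 2) * (2 * (Yoshida1992.fourierCoeff a ((k' : ℤ) + 1) ((Icc (-a) a).indicator fun x : ℝ ↦ ∑ q ∈ so, ((coefo j₁ q : ℝ) : ℂ) * ((x : ℂ)) ^ q)).im / Real.sqrt (2 * a)))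
            + (Λ2o j₂ j₁ + Λ2o j₁ j₂ - ∑ j₀, Λ2o j₀ j₁ * (2 * (∫ x, ((Icc (-a) a).indicator fun x : ℝ ↦ ∑ q ∈ so, ((coefo j₀ q : ℝ) : ℂ) * ((x : ℂ)) ^ q) x * conj (((Icc (-a) a).indicator fun x : ℝ ↦ ∑ q ∈ so, ((coefo j₂ q : ℝ) : ℂ) * ((x : ℂ)) ^ q) x)).re
                        - ∑ k ∈ Finset.range Bo, (2 * (Yoshida1992.fourierCoeff a ((k : ℤ) + 1) ((Icc (-a) a).indicator fun x : ℝ ↦ ∑ q ∈ so, ((coefo j₀ q : ℝ) : ℂ) * ((x : ℂ)) ^ q)).im / Real.sqrt (2 * a)) * (2 * (Yoshida1992.fourierCoeff a ((k : ℤ) + 1) ((Icc (-a) a).indicator fun x : ℝ ↦ ∑ q ∈ so, ((coefo j₂ q : ℝ) : ℂ) * ((x : ℂ)) ^ q)).im / Real.sqrt (2 * a))) - ∑ j₀, Λ2o j₀ j₂ * (2 * (∫ x, ((Icc (-a) a).indicator fun x : ℝ ↦ ∑ q ∈ so, ((coefo j₀ q : ℝ) : ℂ) * ((x : ℂ)) ^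 q) x * conj (((Icc (-a) a).indicator fun x : ℝ ↦ ∑ q ∈ so, ((coefo j₁ q : ℝ) : ℂ) * ((x : ℂ)) ^ q) x)).re
                        - ∑ k ∈ Finset.range Bo, (2 * (Yoshida1992.fourierCoeff a ((k : ℤ) + 1) ((Icc (-a) a).indicator fun x : ℝ ↦ ∑ q ∈ so, ((coefo j₀ q : ℝ) : ℂ) * ((x : ℂ)) ^ q)).im / Real.sqrt (2 * a)) * (2 * (Yoshida1992.fourierCoeff a ((k : ℤ) + 1) ((Icc (-a) a).indicator fun x : ℝ ↦ ∑ q ∈ so, ((coefo j₁ q : ℝ) : ℂ) * ((x : ℂ)) ^ q)).im / Real.sqrt (2 * a))))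
          - ((∑ m ∈ Finset.Ico Bo m₀o,
            ((((weilWindowSesq a ((Icc (-a) a).indicator fun x : ℝ ↦ ∑ q ∈ so, ((coefo j₁ q : ℝ) : ℂ) * ((x : ℂ)) ^ q) (chiOdd a (m + 1))).im / Real.sqrt 2)
                - ∑ k ∈ Finset.Ico 0 Bo, ((gramCoeff a ((k : ℤ) + 1) ((m : ℤ) + 1) - gramCoeff a ((k : ℤ) + 1) (-((m : ℤ) + 1))) / 2) * (2 * (Yoshida1992.fourierCoeff a ((k : ℤ) + 1) ((Icc (-a) a).indicator fun x : ℝ ↦ ∑ q ∈ so, ((coefo j₁ q : ℝ) : ℂ) * ((x : ℂ)) ^ q)).im / Real.sqrt (2 * a)))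
                  - ∑ j, (2 * (Yoshida1992.fourierCoeff a ((m : ℤ) + 1) ((Icc (-a) a).indicator fun x : ℝ ↦ ∑ q ∈ so, ((coefo j q : ℝ) : ℂ) * ((x : ℂ)) ^ q)).im / Real.sqrt (2 * a)) * Λ2o j j₁)
            * ((((weilWindowSesq a ((Icc (-a) a).indicator fun x : ℝ ↦ ∑ q ∈ so, ((coefo j₂ q : ℝ) : ℂ) * ((x : ℂ)) ^ q) (chiOdd a (m + 1))).im / Real.sqrt 2)
                - ∑ k ∈ Finset.Ico 0 Bo, ((gramCoeff a ((k : ℤ) + 1) ((m : ℤ) + 1) - gramCoeff a ((k : ℤ) + 1) (-((m : ℤ) + 1))) / 2) * (2 * (Yoshida1992.fourierCoeff a ((k : ℤ) + 1) ((Icc (-a) a).indicator fun x : ℝ ↦ ∑ q ∈ so, ((coefo j₂ q : ℝ) : ℂ) * ((x : ℂ)) ^ q)).im / Real.sqrt (2 * a)))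
                  - ∑ j, (2 * (Yoshida1992.fourierCoeff a ((m : ℤ) + 1) ((Icc (-a) a).indicator fun x : ℝ ↦ ∑ q ∈ so, ((coefo j q : ℝ) : ℂ) * ((x : ℂ)) ^ q)).im / Real.sqrt (2 * a)) * Λ2o j j₂) / wtabo m) + ((1 + θo) * ((∑ f, ∑ f', ((∑ q ∈ so, coefo j₁ q * Pimgo q f
                      - ∑ n ∈ Finset.Ico 0 Bo, (2 * (Yoshida1992.fourierCoeff a ((n : ℤ) + 1) ((Icc (-a) a).indicator fun x : ℝ ↦ ∑ q ∈ so, ((coefo j₁ q : ℝ) : ℂ) * ((x : ℂ)) ^ q)).im / Real.sqrt (2 * a)) * Prowo n f)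
                    - ∑ j, Rtabo j f * Λ2o j j₁) * ((∑ q ∈ so, coefo j₂ q * Pimgo q f'
                      - ∑ n ∈ Finset.Ico 0 Bo, (2 * (Yoshida1992.fourierCoeff a ((n : ℤ) + 1) ((Icc (-a) a).indicator fun x : ℝ ↦ ∑ q ∈ so, ((coefo j₂ q : ℝ) : ℂ) * ((x : ℂ)) ^ q)).im / Real.sqrt (2 * a)) * Prowo n f')
                    - ∑ j, Rtabo j f' * Λ2o j j₂) * Go f f')
              + ∑ f, co f * ((∑ q ∈ so, coefo j₁ q * Pimgo q f
                      - ∑ n ∈ Finset.Ico 0 Bo, (2 * (Yoshida1992.fourierCoeff a ((n : ℤ) + 1) ((Icc (-a) a).indicator fun x : ℝ ↦ ∑ q ∈ so, ((coefo j₁ q : ℝ) : ℂ) * ((x : ℂ)) ^ q)).im / Real.sqrt (2 * a)) * Prowo n f)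
                    - ∑ j, Rtabo j f * Λ2o j j₁) * ((∑ q ∈ so, coefo j₂ q * Pimgo q f
                      - ∑ n ∈ Finset.Ico 0 Bo, (2 * (Yoshida1992.fourierCoeff a ((n : ℤ) + 1) ((Icc (-a) a).indicator fun x : ℝ ↦ ∑ q ∈ so, ((coefo j₂ q : ℝ) : ℂ) * ((x : ℂ)) ^ q)).im / Real.sqrt (2 * a)) * Prowo n f)
                    - ∑ j, Rtabo j f * Λ2o j j₂))
            + (1 + 1 / θo) * (Wo * ((∑ i : Fin Bo, ρrowo i
                + ∑ j, (∑ q ∈ so, |coefo j q| * ρimgo q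
                    + ∑ n ∈ Finset.Ico 0 Bo, |(2 * (Yoshida1992.fourierCoeff a ((n : ℤ) + 1) ((Icc (-a) a).indicator fun x : ℝ ↦ ∑ q ∈ so, ((coefo j q : ℝ) : ℂ) * ((x : ℂ)) ^ q)).im / Real.sqrt (2 * a))| * ρrowo n))))
              * (if j₁ = j₂ then (∑ q ∈ so, |coefo j₁ q| * ρimgo q
                    + ∑ n ∈ Finset.Ico 0 Bo, |(2 * (Yoshida1992.fourierCoeff a ((n : ℤ) + 1) ((Icc (-a) a).indicator fun x : ℝ ↦ ∑ q ∈ so, ((coefo j₁ q : ℝ) : ℂ) * ((x : ℂ)) ^ q)).im / Real.sqrt (2 * a))| * ρrowo n) else 0)) / d₁o))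
          - if j₁ = j₂ then δo else 0) - (PsdDyadic.getMZ mido (Bo + j₁) (Bo + j₂) : ℝ) * uo| ≤ (ρZo : ℝ) * uo) :
    WeilPositivityOn a :=
  weilPositivityOn_of_cinf_cert ha
    hPA hBe hBme se hse coefe hbe
    (fun m ↦ if m < m₀e then wtabe m else d₁e)
    hd₀e
    (cinf_de_lo wtabe (fun m h1 h2 ↦ (htabe m h1 h2).1) hd₀₁e)
    (hd₀e.trans_le hd₀₁e) (cinf_de_hi wtabe d₁e)
    (cinf_hdle_even ha A hBme wtabe d₁e (fun m h1 h2 ↦ (htabe m h1 h2).2) hd₁e)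
    Λ1e Λ2e φe we Prowe ρrowe hρrowe hrowe Pimge ρimge hρimge himge Rtabe hVe wtabe
    (fun m hm ↦ ⟨hd₀e.trans_le (htabe m (Finset.mem_Ico.1 hm).1 (Finset.mem_Ico.1 hm).2).1,
      by rw [if_pos (Finset.mem_Ico.1 hm).2]⟩)
    hWe Ge ce hΓe hθe hδe hchecke hue hxxe hxβe hβxe hββe hBo hBmo so hso coefo hbo
    (fun k ↦ if k < m₀o then wtabo k else d₁o)
    hd₀o
    (cinf_de_lo wtabo (fun k h1 h2 ↦ (htabo k h1 h2).1) hd₀₁o)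
    (hd₀o.trans_le hd₀₁o) (cinf_de_hi wtabo d₁o)
    (cinf_dhat_le_of_far wtabo (fun k h1 h2 ↦ (htabo k h1 h2).2) hfaro)
    Λ1o Λ2o φo wo Prowo ρrowo hρrowo hrowo Pimgo ρimgo hρimgo himgo Rtabo hVo wtabo
    (fun m hm ↦ ⟨hd₀o.trans_le (htabo m (Finset.mem_Ico.1 hm).1 (Finset.mem_Ico.1 hm).2).1,
      by rw [if_pos (Finset.mem_Ico.1 hm).2]⟩)
    hWo Go co hΓo hθo hδo hchecko huo hxxo hxβo hβxo hββo

end Summit.RiemannHypothesis.RiemannHypothesis.Theorems.WeilFormatC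

end
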